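import Summits.MatrixMultiplication.MatrixMultiplication.Theorems.SoloInformedCwTwoOnePairOrient
import Summits.MatrixMultiplication.MatrixMultiplication.Theorems.SoloInformedCwTwoHalfInduction
import Summits.MatrixMultiplication.MatrixMultiplication.Theorems.SoloInformedCwTwoRigidReduction

/-!
# Both orientations work for one-pair mixed designs; non-rigid two-pair designs have all four
(solo-informed seat, gen 14; CLAIMS c170)

`onePair_orientedHallSix_T` (oriented Theorem A) says that the orientation `T` (trade `s + d ↦ 2s` where forced)
works for every one-pair mixed design.  This file proves the mirror statement for `U` (trade `s + d ↦ 2d` where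
forced): the traded value `2d + ∑A` never exceeds `σ`, because a trade is forced only by a subset sum
`∑B = s + d + ∑A ≤ ∑ t`, and the one asymmetric hypothesis of Theorem A (`hconst`) has the mirror
`∑B = s + d + ∑A₁ → 2d + ∑A₁ ≠ s + ∑A₂`, which again follows from the design weights through a balanced triple of
allowed relations `(-1,-1) + (-1,2) + (2,-1) = 0`.

Consequences: a one-pair mixed design has exactly `2` working orientations (`onePair_workingOrientations_eq_two`),
and by the demotion lemma (`two_mul_workingOrientations_demote_le`, `workingOrientations_reindex`) a TWO-pair mixed
design that is not rigid — some pair can be demoted to two singletons leaving a mixed design — has ALL FOUR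
orientations working (`twoPair_workingOrientations_eq_four_of_not_isRigid`).  Contrapositively every 'hard' two-pair
design (fewer than four working orientations) is rigid (`twoPair_isRigid_of_workingOrientations_lt_four`), which the
seat had observed on all 136 hard designs of its beds (CLAIMS c161) and is now a theorem: THEOREM B (`p = 2`) is
exactly a statement about rigid designs, and these carry an obligation relation at each pair
(`SoloInformedCwTwoObligation`).

Standard axioms only.
-/

namespace Summit.MatrixMultiplication.MatrixMultiplication.Theorems

open Finset

open Classical in
/-- The U-rescue value attached to the complete pair: `s + d + ∑A`, or `2d + ∑A` when the former collides with a
subset sum. -/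
noncomputable def pairValueU {q : ℕ} (t : Fin q → ℕ) (s d : ℕ) (A : Finset (Fin q)) : ℕ :=
  if ∃ B : Finset (Fin q), subsetSum t B = s + d + subsetSum t A then 2 * d + subsetSum t A
  else s + d + subsetSum t A

/-- The U-oriented certifying map `Ψ_U`. -/
noncomputable def psiU {q : ℕ} (t : Fin q → ℕ) (s d : ℕ) : Fin 4 × Finset (Fin q) → ℕ :=
  fun x => (![subsetSum t x.2, s + subsetSum t x.2, d + subsetSum t x.2, pairValueU t s d x.2] : Fin 4 → ℕ) x.1

/-- Every value of `Ψ_U` lies in `[0, s + d + ∑ t]`: a forced trade has `s + d + ∑A = ∑B ≤ ∑ t`, so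
`2d + ∑A ≤ d + ∑ t - s ≤ σ` (no truncation). -/
theorem psiU_le {q : ℕ} (t : Fin q → ℕ) (s d : ℕ) (x : Fin 4 × Finset (Fin q)) :
    psiU t s d x ≤ s + d + ∑ i, t i := by
  obtain ⟨i, A⟩ := x
  have hA := subsetSum_le_total t A
  unfold psiU
  fin_cases i
  · simp; omega
  · simp; omega
  · simp; omega
  · simp only
    show pairValueU t s d A ≤ _
    unfold pairValueU
    split_ifs with h
    · obtain ⟨B, hB⟩ := h
      have hB' := subsetSum_le_total t B
      omega
    · omega

/-- Injectivity of `Ψ_U` under the hypotheses of Theorem A with the mirrored constant-column hypothesis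
`hconstU : ∑B = s + d + ∑A₁ → 2d + ∑A₁ ≠ s + ∑A₂`. -/
theorem psiU_injective {q : ℕ} (t : Fin q → ℕ) (s d : ℕ)
    (hdiss : ∀ A B : Finset (Fin q), subsetSum t A = subsetSum t B → A = B)
    (hs : ∀ A B : Finset (Fin q), subsetSum t B ≠ s + subsetSum t A)
    (hd : ∀ A B : Finset (Fin q), subsetSum t B ≠ d + subsetSum t A)
    (hds : ∀ A B : Finset (Fin q), s + subsetSum t B ≠ d + subsetSum t A)
    (hconstU : ∀ A₁ A₂ B : Finset (Fin q),
      subsetSum t B = s + d + subsetSum t A₁ → 2 * d + subsetSum t A₁ ≠ s + subsetSum t A₂) :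
    Function.Injective (psiU t s d) := by
  classical
  have key : ∀ (A B : Finset (Fin q)), pairValueU t s d A = pairValueU t s d B → A = B := by
    intro A B h
    unfold pairValueU at h
    split_ifs at h with h1 h2 h2
    · exact hdiss A B (by omega)
    · exact absurd (by omega : s + subsetSum t B = d + subsetSum t A) (hds A B)
    · exact absurd (by omega : s + subsetSum t A = d + subsetSum t B) (hds B A)
    · exact hdiss A B (by omega)
  have k0 : ∀ (A B : Finset (Fin q)), subsetSum t A = pairValueU t s d B → False := by
    intro A B h
    unfold pairValueU at h
    split_ifs at h with h1
    · obtain ⟨B₀, hB₀⟩ := h1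
      exact hds B₀ A (by omega)
    · exact h1 ⟨A, h⟩
  have k1 : ∀ (A B : Finset (Fin q)), s + subsetSum t A = pairValueU t s d B → False := by
    intro A B h
    unfold pairValueU at h
    split_ifs at h with h1
    · obtain ⟨B₀, hB₀⟩ := h1
      exact hconstU B A B₀ hB₀ (by omega)
    · exact hd B A (by omega)
  have k2 : ∀ (A B : Finset (Fin q)), d + subsetSum t A = pairValueU t s d B → False := by
    intro A B h
    unfold pairValueU at h
    split_ifs at h with h1
    · exact hd B A (by omega)
    · exact hs B A (by omega)
  rintro ⟨i, A⟩ ⟨j, B⟩ h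
  unfold psiU at h
  fin_cases i <;> fin_cases j <;> simp at h
  all_goals first
    | exact (hs A B (by omega)).elim
    | exact (hs B A (by omega)).elim
    | exact (hd A B (by omega)).elim
    | exact (hd B A (by omega)).elim
    | exact (hds A B (by omega)).elim
    | exact (hds B A (by omega)).elim
    | exact (k0 A B (by omega)).elim
    | exact (k0 B A (by omega)).elim
    | exact (k1 A B (by omega)).elim
    | exact (k1 B A (by omega)).elim
    | exact (k2 A B (by omega)).elim
    | exact (k2 B A (by omega)).elim
    | (cases hdiss A B (by omega); rfl)
    | (cases key A B (by omega); rfl)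

/-- The mirrored constant-column hypothesis follows from the mixed-design property: the three allowed relations
`((-1,-1), 1_B - 1_{A₁})`, `((-1,2), 1_{A₁} - 1_{A₂})`, `((2,-1), 1_{A₂} - 1_B)` would each have weight `≥ 1` and
sum to zero. -/
theorem onePair_hconstU_of_isMixedDesign {q : ℕ} (s d : Fin 1 → ℕ) (t : Fin q → ℕ)
    (hD : IsMixedDesign s d t) :
    ∀ A₁ A₂ B : Finset (Fin q),
      subsetSum t B = s 0 + d 0 + subsetSum t A₁ → 2 * d 0 + subsetSum t A₁ ≠ s 0 + subsetSum t A₂ := by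
  classical
  obtain ⟨_, ys, yd, yt, hy⟩ := hD
  have hy1 : ∀ (a0 b0 : ℤ) (c : Fin q → ℤ), (-1 ≤ a0 ∧ -1 ≤ b0 ∧ a0 + b0 ≤ 1) → (∀ i, -1 ≤ c i ∧ c i ≤ 1) →
      a0 * (s 0 : ℤ) + b0 * (d 0 : ℤ) + ∑ i, c i * (t i : ℤ) = 0 → (a0 ≠ 0 ∨ b0 ≠ 0 ∨ c ≠ 0) →
      1 ≤ a0 * ys 0 + b0 * yd 0 + ∑ i, c i * yt i := by
    intro a0 b0 c hab hc hv hnz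
    have h := hy (fun _ => a0) (fun _ => b0) c ⟨fun _ => hab, hc⟩
      (by simpa [Fin.sum_univ_one] using hv)
      (by
        rcases hnz with h | h | h
        · left; intro hz; exact h (by simpa using congrFun hz 0)
        · right; left; intro hz; exact h (by simpa using congrFun hz 0)
        · right; right; exact h)
    simpa [Fin.sum_univ_one] using h
  have vss : ∀ A B : Finset (Fin q),
      (∑ i, (chiZ A i - chiZ B i) * (t i : ℤ)) = (subsetSum t A : ℤ) - (subsetSum t B : ℤ) := by
    intro A B
    rw [subsetSum_eq_chi, subsetSum_eq_chi, ← Finset.sum_sub_distrib]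
    apply Finset.sum_congr rfl; intro i _; ring
  intro A₁ A₂ B h1 h2
  have h1' : ((subsetSum t B : ℕ) : ℤ) = (s 0 : ℤ) + (d 0 : ℤ) + (subsetSum t A₁ : ℤ) := by exact_mod_cast h1
  have h2' : 2 * (d 0 : ℤ) + (subsetSum t A₁ : ℤ) = (s 0 : ℤ) + (subsetSum t A₂ : ℤ) := by exact_mod_cast h2
  let c1 : Fin q → ℤ := fun i => chiZ B i - chiZ A₁ i
  let c2 : Fin q → ℤ := fun i => chiZ A₁ i - chiZ A₂ i
  let c3 : Fin q → ℤ := fun i => chiZ A₂ i - chiZ B i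
  have i1 := hy1 (-1) (-1) c1 (by norm_num) (fun i => chiZ_sub_bound B A₁ i)
    (by simp only [c1]; rw [vss]; linarith) (by left; norm_num)
  have i2 := hy1 (-1) 2 c2 (by norm_num) (fun i => chiZ_sub_bound A₁ A₂ i)
    (by simp only [c2]; rw [vss]; linarith) (by left; norm_num)
  have i3 := hy1 2 (-1) c3 (by norm_num) (fun i => chiZ_sub_bound A₂ B i)
    (by simp only [c3]; rw [vss]; linarith) (by left; norm_num)
  have hsum : (∑ i, c1 i * yt i) + (∑ i, c2 i * yt i) + (∑ i, c3 i * yt i) = 0 := by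
    rw [← Finset.sum_add_distrib, ← Finset.sum_add_distrib]
    apply Finset.sum_eq_zero; intro i _; simp only [c1, c2, c3]; ring
  linarith

open Classical in
/-- The U-oriented choice of representatives realising `Ψ_U`: trade `s + d ↦ 2d` exactly when `s + d + ∑A` is a
subset sum. -/
noncomputable def psiChoiceU {q : ℕ} (s d : Fin 1 → ℕ) (t : Fin q → ℕ) (m : HWord 1 q) : Fin 1 → Fin 3 :=
  fun _ => if ∃ B : Finset (Fin q), subsetSum t B = s 0 + d 0 + subsetSum t m.2 then 2 else 1

/-- The representative chosen by `psiChoiceU` has the value `Ψ_U`. -/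
theorem candVal_psiChoiceU {q : ℕ} (s d : Fin 1 → ℕ) (t : Fin q → ℕ) (m : HWord 1 q) :
    candVal s d t m (psiChoiceU s d t m) = psiU t (s 0) (d 0) (m.1 0, m.2) := by
  classical
  obtain ⟨L, A⟩ := m
  have hss : ∑ i ∈ A, t i = subsetSum t A := rfl
  unfold candVal psiU
  simp only [Fin.sum_univ_one, hss]
  generalize hℓ : L 0 = ℓ
  fin_cases ℓ
  · simp
  · simp
  · simp
  · simp only [Fin.reduceFinMk, ↓reduceIte, psiChoiceU, pairValueU]
    simp only [Fin.isValue, Matrix.cons_val]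
    split_ifs <;> simp

/-- **Oriented Theorem A, U side.**  For every one-pair mixed design the orientation `U` (all trades towards `2d`)
works. -/
theorem onePair_orientedHallSix_U {q : ℕ} (s d : Fin 1 → ℕ) (t : Fin q → ℕ) (hD : IsMixedDesign s d t) :
    OrientedHallSix s d t (fun _ => true) := by
  classical
  obtain ⟨hdiss, hs, hd, hds, -⟩ := onePair_hypotheses_of_isMixedDesign s d t hD
  have hconstU := onePair_hconstU_of_isMixedDesign s d t hD
  have hinj := psiU_injective t (s 0) (d 0) hdiss hs hd hds hconstU
  refine ⟨psiChoiceU s d t, fun m k => ?_, fun m => ?_, fun m₁ m₂ hm => ?_⟩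
  · by_cases h : ∃ B : Finset (Fin q), subsetSum t B = s 0 + d 0 + subsetSum t m.2
    · right; simp [psiChoiceU, h]
    · left; simp [psiChoiceU, h]
  · rw [candVal_psiChoiceU]
    have := psiU_le t (s 0) (d 0) (m.1 0, m.2)
    simpa [mixedSigma, Fin.sum_univ_one, Nat.add_assoc] using this
  · have h' : psiU t (s 0) (d 0) (m₁.1 0, m₁.2) = psiU t (s 0) (d 0) (m₂.1 0, m₂.2) := by
      have := hm
      simp only [candVal_psiChoiceU] at this
      exact this
    have hpair := hinj h'
    simp only [Prod.mk.injEq] at hpair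
    refine Prod.ext (funext fun k => ?_) hpair.2
    rw [Fin.eq_zero k]
    exact hpair.1

/-- Hence EVERY orientation works for a one-pair mixed design. -/
theorem onePair_orientedHallSix_all {q : ℕ} (s d : Fin 1 → ℕ) (t : Fin q → ℕ) (hD : IsMixedDesign s d t)
    (o : Fin 1 → Bool) : OrientedHallSix s d t o := by
  have ho : o = fun _ => o 0 := funext fun k => by rw [Fin.eq_zero k]
  rw [ho]
  cases o 0
  · exact onePair_orientedHallSix_T s d t hD
  · exact onePair_orientedHallSix_U s d t hD

/-- A one-pair mixed design has exactly two working orientations (`T` and `U`). -/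
theorem onePair_workingOrientations_eq_two {q : ℕ} (s d : Fin 1 → ℕ) (t : Fin q → ℕ)
    (hD : IsMixedDesign s d t) : workingOrientations s d t = 2 := by
  classical
  unfold workingOrientations
  rw [Finset.filter_true_of_mem (fun o _ => onePair_orientedHallSix_all s d t hD o)]
  simp

/-- The number of working orientations never exceeds `2 ^ p`. -/
theorem workingOrientations_le_two_pow {p q : ℕ} (s d : Fin p → ℕ) (t : Fin q → ℕ) :
    workingOrientations s d t ≤ 2 ^ p := by
  classical
  unfold workingOrientations
  calc _ ≤ (Finset.univ : Finset (Fin p → Bool)).card := Finset.card_filter_le _ _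
    _ = 2 ^ p := by simp

/-- **Non-rigid two-pair designs have all four orientations working.**  If some pair of a two-pair mixed system can
be demoted to two singletons leaving a mixed design, then by the demotion lemma and
`onePair_workingOrientations_eq_two` all `4` one-sided orientations work. -/
theorem twoPair_workingOrientations_eq_four_of_not_isRigid {q : ℕ} (s d : Fin 2 → ℕ) (t : Fin q → ℕ)
    (h : ¬ IsRigid s d t) : workingOrientations s d t = 4 := by
  classical
  simp only [IsRigid, not_forall, not_not] at h
  obtain ⟨σ, hdem⟩ := h
  have h2 := onePair_workingOrientations_eq_two _ _ _ hdem
  have hle := two_mul_workingOrientations_demote_le (fun k => s (σ k)) (fun k => d (σ k)) t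
  have hre := workingOrientations_reindex s d t σ
  have hub := workingOrientations_le_two_pow s d t
  have h2' : workingOrientations (fun i : Fin 1 => s (σ i.castSucc)) (fun i => d (σ i.castSucc))
      (demoteT (fun k => s (σ k)) (fun k => d (σ k)) t) = 2 := h2
  rw [h2'] at hle
  rw [hre] at hle
  norm_num at hub
  omega

/-- Contrapositive: a two-pair mixed system with fewer than four working orientations (a 'hard' design) is rigid —
no pair can be demoted to singletons leaving a mixed design; so THEOREM B concerns rigid designs only, each of
which carries an obligation relation at both pairs. -/
theorem twoPair_isRigid_of_workingOrientations_lt_four {q : ℕ} (s d : Fin 2 → ℕ) (t : Fin q → ℕ)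
    (h : workingOrientations s d t < 4) : IsRigid s d t := by
  by_contra hr
  have := twoPair_workingOrientations_eq_four_of_not_isRigid s d t hr
  omega

end Summit.MatrixMultiplication.MatrixMultiplication.Theorems
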